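import Summits.Langlands.Langlands.Theorems.IrreducibilityBySelfDualityPairLBoundaryJSCornerGlobalTranslatePart1

/-!
# The corner global theorem in TRANSLATE form: `I(s; Φ, Φ̄') = C · w_{s-1/2}(τ) · L^{S'}(s, α ⊗ γ̄) · Ψ^τ_{S'}(s - 1/2)`

Summit `Langlands`, sub-problem `Langlands`, helper file under `Theorems/` supporting the crux
`PairLBoundaryJS` (stmt-Langlands-13622), line `Sketch`, registered stub `stub_corner_global_translate`
(W-CGT): the `GL_{m+1} × GL_m` ("corner") analogue of
`GlobalPairTranslateGen.stub_global_pair_translate_gen`. For `0 < m` there is `C > 0` (Haar measures) such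
that for cuspidal `π` on `GL_{m+1}(𝔸_K)`, `σ` on `GL_m(𝔸_K)` with Satake families `α`, `γ` off `S`, HONEST
continuous representatives `Φ`, `Φ'` of vectors of `π`, `σ`, right `K(𝔫₀)`-invariant, every `S' ⊇ S` off
which `v ∤ 𝔫₀`, every `τ ∈ (𝔸_Kˣ)ᵐ` whose extension `(τ, 1)` corrects the conductor of Tate's character off
`S'`, and all enumerations `x`, `y` of `α`, `γ` off `S'`, on a right half-plane

  `I(s; Φ, Φ̄') = C · w_{s-1/2}(τ) · L^{S'}(s, α ⊗ γ̄) · ∫_{B({v ∉ S'}) × K} W_Φ(diag(τ,1) ι ·) W̄_{Φ'}(diag τ ·) |det|^{s-1/2} δ⁻¹`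

(Cogdell (2004), Thm. 2.1–2.2, §3.1, Thm. 3.3, §4.2; Jacquet–Piatetski-Shapiro–Shalika (1983), §2).
Assembly (`jpssIntegral_star_eq`): the global corner theorem
`CornerGlobal.jpssIntegral_eq_mul_integral_torusPairIntegrandC` at `(Φ, Φ̄')` (`IsCuspFormGL.star`), its
torus hypothesis from `CornerAbsConvergence.stub_corner_abs_convergence_one_of_torus_majorant` with
`CornerAbsTorusMajorant.stub_corner_torus_majorant` on `re s > σ₀ + 1/2`; the bridge
`whittakerDepth_zero_eq_whittakerCoeff`; the torus substitution `a ↦ τ a` of part 1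
(`CornerGlobalTranslatePart1`); the honest translated unramified data at every `v ∉ S'`
(`HonestTranslateUnramified.exists_isTorusUnramifiedAt_whittakerCoeff_of_ae_eq_translate` for `π` with
`T = diag(τ, 1)` and for `σ` with `T = diag τ`), `IsTorusUnramifiedAt.star`, `IsTorusUnramifiedAt.of_valued_eq`,
the Satake bound `norm_satakeParameter_le_sqrt_holds`, the central character of `π`
(`exists_centralCharacter_invQuot`); the Euler factorisation over all good places
`CornerEulerLimit.integral_eq_mul_setIntegral_of_hasProd` at the parameter `s - 1/2` and the Euler product
`hasProd_partialPairL` at `s` (`σ̄ = Q.conj`, `IsSatakeFamilyOf.conj`).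

## References

* J. W. Cogdell, *Analytic theory of L-functions for GL_n*, in *An Introduction to the Langlands
  Program* (2004), §2.2–2.3 Thm. 2.1–2.2, §3.1 Thm. 3.3, §4.2 [CogdellAnalyticTheory2004].
* H. Jacquet, I. I. Piatetski-Shapiro, J. Shalika, *Rankin–Selberg convolutions*, Amer. J. Math.
  105 (1983), §2 [JacquetPiatetskiShapiroShalika1983].
* H. Jacquet, J. A. Shalika, *On Euler products and the classification of automorphic
  representations I*, Amer. J. Math. 103 (1981), §2 Prop. (2.3), §4 [JacquetShalikaAJM1981].
-/

noncomputable section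

-- `Summit.Langlands.Langlands.…` (summit = sub-problem name, D-0017 layout) trips `dupNamespace`
set_option linter.dupNamespace false

open scoped MatrixGroups Topology Pointwise ENNReal NNReal ComplexConjugate InnerProductSpace ContDiff
-- the place subtypes indexing `mixedSpace K` are `Fintype` classically (`NormedCommRing (mixedSpace K)`)
open scoped Classical Matrix.Norms.Operator
open NumberField IsDedekindDomain MeasureTheory Measure Matrix Set Filter WithZero
open NumberField.mixedEmbedding
open Literature.NumberTheory.Automorphic AdelicGroupData
open Literature.NumberTheory.GaloisRepresentations (ideleGroup HeckeCharacter)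
open Literature.MeasureTheory.Group
open Literature.RingTheory.SymmetricFunctions.SymmPoly
open ValuativeRel

-- the automorphic quotient carries the tree's Borel σ-algebra, not Mathlib's quotient σ-algebra
attribute [-instance] Quotient.instMeasurableSpace QuotientGroup.measurableSpace

-- the house local instances, exactly as in `RankinSelbergUnfoldingIdentity`
attribute [local instance] adelicBorel borelSpace_adelic locallyCompactSpace_adelic secondCountableTopology_gl_adelic
  glAdeleBorel borelSpace_glAdele borelSpace_ideleGroup secondCountableTopology_ideleGroup

-- Mathlib idiom: the commutator Lie ring on matrices, to mention `(archGroupGL n K).lie`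
attribute [local instance 100] LieRing.ofAssociativeRing

namespace Summit.Langlands.Langlands.Theorems.CornerGlobalTranslate

/-! ### The corner global theorem in translate form -/

section Main

variable {m : ℕ} {K : Type} [Field K] [NumberField K]
  [MeasurableSpace (AdeleRing (𝓞 K) K)] [BorelSpace (AdeleRing (𝓞 K) K)]

local notation "𝔸" => AdeleRing (𝓞 K) K

/-- **The corner global theorem in translate form** (Cogdell (2004), Thm. 2.1–2.2 (Eulerian clause), §3.1
"translate the essential vector", Thm. 3.3, §4.2; Jacquet–Piatetski-Shapiro–Shalika (1983), §2). For
`0 < m` there is `C > 0` (the constant of the global corner theorem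
`CornerGlobal.jpssIntegral_eq_mul_integral_torusPairIntegrandC`, depending only on the Haar measures) such that
for cuspidal `π` on `GL_{m+1}(𝔸_K)`, `σ` on `GL_m(𝔸_K)` with Satake families `α`, `γ` off `S`, honest
continuous representatives `Φ`, `Φ'` of `sv ∈ π`, `sv' ∈ σ`, right `K(𝔫₀)`-invariant, every `S' ⊇ S` off
which `v ∤ 𝔫₀`, every `τ ∈ (𝔸_Kˣ)ᵐ` whose extension `(τ, 1)` realises at every `v ∉ S'` a diagonal shift of
constant ratio `a_v` with `ψ_{K,v}(a_v ·)` of conductor `𝒪_v`, and all enumerations `x`, `y` of `α`, `γ` off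
`S'`, there is `x₀` with, for `re s > x₀`,
`I(s; Φ, Φ̄') = C · w_{s-1/2}(τ) · L^{S'}(s, α ⊗ γ̄) · ∫_{B({v ∉ S'}) × K} I^τ_{s-1/2}`, `I^τ` the corner pair
integrand of `W_Φ(diag(τ, 1) ι ·)` and `W̄_{Φ'}(diag τ ·)`.
[cite: CogdellAnalyticTheory2004, §2.3 Thm. 2.1–2.2, §3.1 Thm. 3.3, §4.2] -/
theorem jpssIntegral_star_eq (hm : 0 < m)
    (μ : Measure (AdelicGroupData.gl (m + 1) K).automorphicQuotient)
    [(AdelicGroupData.gl (m + 1) K).IsAutomorphicMeasure μ]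
    (μ' : Measure (AdelicGroupData.gl m K).automorphicQuotient) [(AdelicGroupData.gl m K).IsAutomorphicMeasure μ']
    (νA : Measure (Fin m → ideleGroup K)) [IsHaarMeasure νA]
    (νK : Measure ↥(maximalCompactAdelic m K)) [IsHaarMeasure νK]
    (ν₀ : Measure ↥(adelicUnipotent (m + 1) K)) [IsHaarMeasure ν₀]
    (ν₀' : Measure ↥(adelicUnipotent m K)) [IsHaarMeasure ν₀'] :
    ∃ C : ℝ, 0 < C ∧
      ∀ (P : CuspidalAutomorphicRepGL (m + 1) K μ) (Q : CuspidalAutomorphicRepGL m K μ')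
        {S : Set (HeightOneSpectrum (𝓞 K))} {α γ : SatakeFamily K},
        IsSatakeFamilyOf P S α → IsSatakeFamilyOf Q S γ →
      ∀ {Φ : (AdelicGroupData.gl (m + 1) K).automorphicQuotient → ℂ}
        {Φ' : (AdelicGroupData.gl m K).automorphicQuotient → ℂ}, Continuous Φ → Continuous Φ' →
      ∀ (sv : P.1.toSubmodule) (sv' : Q.1.toSubmodule),
        (((sv : (AdelicGroupData.gl (m + 1) K).L2 μ) : (AdelicGroupData.gl (m + 1) K).automorphicQuotient → ℂ)
          =ᵐ[μ] Φ) →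
        (((sv' : (AdelicGroupData.gl m K).L2 μ') : (AdelicGroupData.gl m K).automorphicQuotient → ℂ) =ᵐ[μ'] Φ') →
        IsCuspFormGL (m + 1) K (isCompact_glFiniteIntegralLevel_holds (m + 1) K)
          (invQuot (AdelicGroupData.gl (m + 1) K) Φ) →
        IsCuspFormGL m K (isCompact_glFiniteIntegralLevel_holds m K) (invQuot (AdelicGroupData.gl m K) Φ') →
      ∀ {𝔫₀ : Ideal (𝓞 K)}, 𝔫₀ ≠ 0 →
        (∀ k ∈ principalCongruenceLevel (m + 1) K 𝔫₀, ∀ y : GL (Fin (m + 1)) (AdeleRing (𝓞 K) K),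
          invQuot (AdelicGroupData.gl (m + 1) K) Φ (y * k) = invQuot (AdelicGroupData.gl (m + 1) K) Φ y) →
        (∀ k ∈ principalCongruenceLevel m K 𝔫₀, ∀ y : GL (Fin m) (AdeleRing (𝓞 K) K),
          invQuot (AdelicGroupData.gl m K) Φ' (y * k) = invQuot (AdelicGroupData.gl m K) Φ' y) →
      ∀ {S' : Set (HeightOneSpectrum (𝓞 K))}, S ⊆ S' → (∀ v ∉ S', ¬ v.asIdeal ∣ 𝔫₀) →
      ∀ (τ : Fin m → ideleGroup K),
        (∀ v ∉ S', ∃ (d : Fin (m + 1) → (v.adicCompletion K)ˣ) (a : (v.adicCompletion K)ˣ),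
          localComponent v (glDiagonal (m + 1) (AdeleRing (𝓞 K) K) (Fin.snoc τ 1)) =
            diagonalGL (Fin (m + 1)) (v.adicCompletion K) d ∧
          (∀ i j : Fin (m + 1), (i : ℕ) + 1 = j →
            (d i : v.adicCompletion K) * ((d j)⁻¹ : (v.adicCompletion K)ˣ) = a) ∧
          (∀ c ∈ 𝒪[v.adicCompletion K], (adeleAddChar K).adicComponent v (a * c) = 1) ∧
          ∀ ϖ : v.adicCompletion K, Valued.v ϖ = WithZero.exp (-1 : ℤ) →
            ∃ c ∈ 𝒪[v.adicCompletion K], (adeleAddChar K).adicComponent v (a * (ϖ⁻¹ * c)) ≠ 1) →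
      ∀ {x : HeightOneSpectrum (𝓞 K) → Fin (m + 1) → ℂ} {y : HeightOneSpectrum (𝓞 K) → Fin m → ℂ},
        (∀ v ∉ S', (Finset.univ : Finset (Fin (m + 1))).val.map (x v) = α v) →
        (∀ v ∉ S', (Finset.univ : Finset (Fin m)).val.map (y v) = γ v) →
      ∃ x₀ : ℝ, ∀ s : ℂ, x₀ < s.re →
        jpssIntegral (Nat.lt_succ_self m) μ' Φ (star Φ') s =
          (C : ℂ) * (torusWeightC m K (s - 1 / 2) τ *
            (partialPairL S' α (fun v => (γ v).map conj) s *
              ∫ p in unitBox {v | v ∉ S'} ×ˢ Set.univ, torusPairIntegrandC m K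
                (fun g => whittakerCoeff ν₀ (unipotentTateDomain (m + 1) K) (adeleAddChar K)
                  (invQuot (AdelicGroupData.gl (m + 1) K) Φ)
                  (glDiagonal (m + 1) (AdeleRing (𝓞 K) K) (Fin.snoc τ 1) *
                    glCorner (AdeleRing (𝓞 K) K) (Nat.le_succ m) g))
                (fun g => star (whittakerCoeff ν₀' (unipotentTateDomain m K) (adeleAddChar K)
                  (invQuot (AdelicGroupData.gl m K) Φ') (glDiagonal m (AdeleRing (𝓞 K) K) τ * g)))
                (fun _ => (1 : ℝ)) (s - 1 / 2) p ∂(νA.prod νK))) := by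
  -- second countability / local compactness (measurability on the torus coordinates, s-finiteness)
  haveI : T2Space (GL (Fin m) 𝔸) := t2Space_gl m K
  haveI : LocallyCompactSpace (GL (Fin m) 𝔸) :=
    AdelicGroupData.locallyCompactSpace_generalLinearGroup_adeleRing K (Fin m)
  haveI : SecondCountableTopology (GL (Fin m) 𝔸) := secondCountableTopology_generalLinearGroup_adeleRing K (Fin m)
  haveI : SecondCountableTopology (AdelicGroupData.gl m K).Adelic :=
    secondCountableTopology_generalLinearGroup_adeleRing K (Fin m)
  haveI : SecondCountableTopology ↥(maximalCompactAdelic m K) := TopologicalSpace.Subtype.secondCountableTopology _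
  haveI := locallyCompactSpace_ideleGroup K
  haveI : CompactSpace ↥(maximalCompactAdelic m K) :=
    isCompact_iff_compactSpace.1 (isCompact_maximalCompactAdelic m K)
  haveI hν₀R : ν₀.IsMulRightInvariant := isMulRightInvariant_of_isHaarMeasure_adelicUnipotent ν₀
  haveI hν₀'R : ν₀'.IsMulRightInvariant := isMulRightInvariant_of_isHaarMeasure_adelicUnipotent ν₀'
  -- the constant of the global corner theorem
  obtain ⟨C, hC, hG⟩ := CornerGlobal.jpssIntegral_eq_mul_integral_torusPairIntegrandC hm μ' νA νK
  refine ⟨C, hC, ?_⟩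
  intro P Q S α γ hα hγ Φ Φ' hΦc hΦ'c sv sv' hae hae' hcusp hcusp' 𝔫₀ h𝔫₀ hΦU hΦ'U S' hSS' hGood τ hτψ x y
    hx hy
  -- Tate's character and boxes
  have hψ : IsGlobalAddChar K (adeleAddChar K) := isGlobalAddChar_adeleAddChar (K := K)
  have h𝓕 : IsFundamentalDomain ↥(rationalUnipotent (m + 1) K) (unipotentTateDomain (m + 1) K) ν₀ :=
    isFundamentalDomain_unipotentTateDomain ν₀
  have h𝓕' : IsFundamentalDomain ↥(rationalUnipotent m K) (unipotentTateDomain m K) ν₀' :=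
    isFundamentalDomain_unipotentTateDomain ν₀'
  have h𝓕c : IsCompact (closure (unipotentTateDomain (m + 1) K)) := isCompact_closure_unipotentTateDomain
  have h𝓕c' : IsCompact (closure (unipotentTateDomain m K)) := isCompact_closure_unipotentTateDomain
  have h𝓕m : MeasurableSet (unipotentTateDomain (m + 1) K) := measurableSet_unipotentTateDomain
  have h𝓕m' : MeasurableSet (unipotentTateDomain m K) := measurableSet_unipotentTateDomain
  -- the classical functions `φ`, `φ'` and their global Whittaker coefficients `W`, `W'`
  set φ : GL (Fin (m + 1)) 𝔸 → ℂ := invQuot (AdelicGroupData.gl (m + 1) K) Φ with hφdef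
  set φ' : GL (Fin m) 𝔸 → ℂ := invQuot (AdelicGroupData.gl m K) Φ' with hφ'def
  have hφc : Continuous φ := hcusp.1.continuous_gl
  have hφ'c : Continuous φ' := hcusp'.1.continuous_gl
  have hφA : ∀ z ∈ (AdelicGroupData.gl (m + 1) K).center', ∀ g : (AdelicGroupData.gl (m + 1) K).Adelic,
      φ (z * g) = φ g := fun z hz g => invQuot_mul_left _ Φ (Subgroup.mem_sup_left hz) g
  have hφ'A : ∀ z ∈ (AdelicGroupData.gl m K).center', ∀ g : (AdelicGroupData.gl m K).Adelic,
      φ' (z * g) = φ' g := fun z hz g => invQuot_mul_left _ Φ' (Subgroup.mem_sup_left hz) g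
  set W : GL (Fin (m + 1)) 𝔸 → ℂ := whittakerCoeff ν₀ (unipotentTateDomain (m + 1) K) (adeleAddChar K) φ
    with hWdef
  set W' : GL (Fin m) 𝔸 → ℂ := whittakerCoeff ν₀' (unipotentTateDomain m K) (adeleAddChar K) φ' with hW'def
  have hWc : Continuous W := continuous_whittakerCoeff h𝓕m h𝓕c hψ.continuous hφc
  have hW'c : Continuous W' := continuous_whittakerCoeff h𝓕m' h𝓕c' hψ.continuous hφ'c
  -- the bridge `Φ_0 = W_Φ`
  have hW₀ : ∀ g, whittakerDepth 0 φ g = W g := fun g =>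
    whittakerDepth_zero_eq_whittakerCoeff hφc (Nat.succ_le_succ (Nat.zero_le m)) ν₀ g
  have hW₀' : ∀ g, whittakerDepth 0 φ' g = W' g := fun g =>
    whittakerDepth_zero_eq_whittakerCoeff hφ'c hm ν₀' g
  have hcc : (fun x : GL (Fin m) 𝔸 => conj (invQuot (AdelicGroupData.gl m K) (star Φ') x)) = φ' := by
    funext x
    simp only [hφ'def, invQuot_apply, Pi.star_apply, starRingEnd_apply, star_star]
  have hW₁ : ∀ g, whittakerDepth 0 (fun x => conj (invQuot (AdelicGroupData.gl m K) (star Φ') x)) g = W' g :=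
    fun g => by rw [hcc]; exact hW₀' g
  -- `W'` is bounded
  obtain ⟨M, hM⟩ := hcusp'.bounded_of_center' hφ'A
  have hM0 : 0 ≤ M := (norm_nonneg _).trans (hM 1)
  have hW'b : ∀ g, ‖W' g‖ ≤ M := fun g => by rw [← hW₀' g]; exact norm_whittakerDepth_le hM 0 g
  -- the right half-plane: one-factor absolute convergence beyond `σ₀`, the Euler product beyond `1`
  obtain ⟨σ₀, hσ₀⟩ := CornerAbsConvergence.stub_corner_abs_convergence_one_of_torus_majorant
    CornerAbsTorusMajorant.stub_corner_torus_majorant hm νA νK hcusp hφA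
  refine ⟨max (σ₀ + 1 / 2) 1, fun s hs => ?_⟩
  have hs1 : 1 < s.re := lt_of_le_of_lt (le_max_right _ _) hs
  have hsσ : σ₀ ≤ s.re - 1 / 2 := by linarith [le_max_left (σ₀ + 1 / 2) (1 : ℝ)]
  have hre : (s - 1 / 2).re = s.re - 1 / 2 := by simp [Complex.sub_re]
  have hs' : 1 / 2 < (s - 1 / 2).re := by rw [hre]; linarith
  have hfin := hσ₀ (s.re - 1 / 2) hsσ
  -- (1) the global corner theorem at `(Φ, Φ̄')`
  have hφ'star : IsCuspFormGL m K (isCompact_glFiniteIntegralLevel_holds m K)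
      (invQuot (AdelicGroupData.gl m K) (star Φ')) := hcusp'.star
  have hglob := hG (φ := Φ) hcusp (φ' := star Φ') hφ'star s hfin
  -- (2) the unfolded integrand in the coefficients `W`, `W'`
  set I₁ : (Fin m → ideleGroup K) × ↥(maximalCompactAdelic m K) → ℂ := torusPairIntegrandC m K
    (fun g => W (glCorner 𝔸 (Nat.le_succ m) g)) (fun g => star (W' g)) (fun _ => (1 : ℝ)) (s - 1 / 2) with hI₁
  have h01 : ∀ p, torusPairIntegrandC m K (fun g => whittakerDepth 0 φ (glCorner 𝔸 (Nat.le_succ m) g))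
      (fun g => conj (whittakerDepth 0 (fun x => conj (invQuot (AdelicGroupData.gl m K) (star Φ') x)) g))
      (fun _ => (1 : ℝ)) (s - 1 / 2) p = I₁ p := fun p => by
    simp only [hI₁, torusPairIntegrandC, hW₀, hW₁]
    rfl
  -- integrability of `I₁`: the torus hypothesis and the bound `‖W'‖ ≤ M`
  have hpt : Measurable (torusPoint m K) := continuous_torusPoint.measurable
  have hI₁m : Measurable I₁ :=
    measurable_torusPairIntegrandC ((hWc.comp (continuous_glCorner _)).measurable.comp hpt)
      (hW'c.star.measurable.comp hpt) measurable_const _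
  have hfinW : ∫⁻ p, ‖W (glCorner 𝔸 (Nat.le_succ m) (torusPoint m K p))‖ₑ *
      ENNReal.ofReal (torusWeight m K (s.re - 1 / 2) p.1) ∂(νA.prod νK) < ⊤ := by
    simpa only [hW₀] using hfin
  have hint₁ : Integrable I₁ (νA.prod νK) := by
    refine ⟨hI₁m.aestronglyMeasurable, ?_⟩
    have hRL : ∫⁻ p, ENNReal.ofReal M * (‖W (glCorner 𝔸 (Nat.le_succ m) (torusPoint m K p))‖ₑ *
        ENNReal.ofReal (torusWeight m K (s.re - 1 / 2) p.1)) ∂(νA.prod νK) < ⊤ := by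
      rw [lintegral_const_mul' _ _ ENNReal.ofReal_ne_top]
      exact ENNReal.mul_lt_top ENNReal.ofReal_lt_top hfinW
    refine lt_of_le_of_lt (lintegral_mono fun p => ?_) hRL
    have h1 : ‖I₁ p‖ₑ = ENNReal.ofReal ‖I₁ p‖ := (ofReal_norm _).symm
    have h2 : ‖W (glCorner 𝔸 (Nat.le_succ m) (torusPoint m K p))‖ₑ =
        ENNReal.ofReal ‖W (glCorner 𝔸 (Nat.le_succ m) (torusPoint m K p))‖ := (ofReal_norm _).symm
    rw [h1, h2, ← ENNReal.ofReal_mul (norm_nonneg _), ← ENNReal.ofReal_mul hM0]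
    refine ENNReal.ofReal_le_ofReal ?_
    rw [hI₁, norm_torusPairIntegrandC, hre, abs_one, mul_one]
    calc ‖W (glCorner 𝔸 (Nat.le_succ m) (torusPoint m K p))‖ * ‖star (W' (torusPoint m K p))‖ *
          torusWeight m K (s.re - 1 / 2) p.1
        ≤ ‖W (glCorner 𝔸 (Nat.le_succ m) (torusPoint m K p))‖ * M * torusWeight m K (s.re - 1 / 2) p.1 :=
          mul_le_mul_of_nonneg_right (mul_le_mul_of_nonneg_left (by rw [norm_star]; exact hW'b _)
            (norm_nonneg _)) (torusWeight_nonneg _ _)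
      _ = M * (‖W (glCorner 𝔸 (Nat.le_succ m) (torusPoint m K p))‖ * torusWeight m K (s.re - 1 / 2) p.1) := by
          ring
  -- (3) the torus substitution `a ↦ τ a`
  have htr := CornerGlobalTranslatePart1.integral_torusPairIntegrandC_corner_translate νA νK W
    (fun g => star (W' g)) τ (s - 1 / 2)
  have hintτ := CornerGlobalTranslatePart1.integrable_torusPairIntegrandC_corner_translate νA νK W
    (fun g => star (W' g)) τ hint₁
  beta_reduce at htr hintτ
  -- (4) the honest translated unramified data at every `v ∉ S'`
  have hSv : ∀ v ∉ S', v ∉ S := fun v hv h => hv (hSS' h)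
  have hex : ∀ v ∉ S', ∃ ϖ : (v.adicCompletion K)ˣ, IsTorusUnramifiedAt (m + 1) K
      (fun g => W (glDiagonal (m + 1) 𝔸 (Fin.snoc τ 1) * g)) v ϖ (x v) := fun v hv => by
    obtain ⟨d, a, hT, hd, hψa, hψa'⟩ := hτψ v hv
    exact HonestTranslateUnramified.exists_isTorusUnramifiedAt_whittakerCoeff_of_ae_eq_translate P hα h𝔫₀
      (hSv v hv) (hGood v hv) hΦc sv hae hΦU (hx v hv) h𝓕 h𝓕c hψ hT hd hψa hψa'
  have hex' : ∀ v ∉ S', ∃ ϖ : (v.adicCompletion K)ˣ, IsTorusUnramifiedAt m K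
      (fun g => W' (glDiagonal m 𝔸 τ * g)) v ϖ (y v) := fun v hv => by
    obtain ⟨d, a, hT, hd, hψa, hψa'⟩ := hτψ v hv
    exact HonestTranslateUnramified.exists_isTorusUnramifiedAt_whittakerCoeff_of_ae_eq_translate Q hγ h𝔫₀
      (hSv v hv) (hGood v hv) hΦ'c sv' hae' hΦ'U (hy v hv) h𝓕' h𝓕c' hψ
      (CornerGlobalTranslatePart1.localComponent_glDiagonal_eq_of_snoc hT)
      (fun i j hij => hd (Fin.castSucc i) (Fin.castSucc j) (by simpa only [Fin.val_castSucc] using hij))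
      hψa hψa'
  let ϖ : ∀ v : HeightOneSpectrum (𝓞 K), (v.adicCompletion K)ˣ := fun v =>
    if hv : v ∉ S' then Classical.choose (hex v hv) else 1
  have hWu : ∀ v ∉ S', IsTorusUnramifiedAt (m + 1) K (fun g => W (glDiagonal (m + 1) 𝔸 (Fin.snoc τ 1) * g)) v
      (ϖ v) (x v) := fun v hv => by
    simp only [ϖ, dif_pos hv]
    exact Classical.choose_spec (hex v hv)
  have hW'u : ∀ v ∉ S', IsTorusUnramifiedAt m K (fun g => star (W' (glDiagonal m 𝔸 τ * g))) v (ϖ v)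
      (star (y v)) := fun v hv => by
    obtain ⟨ϖ', hϖ'⟩ := hex' v hv
    exact (hϖ'.of_valued_eq (hWu v hv).valued_eq).star
  -- the central character of `π`: `‖W^τ‖` is central-invariant
  have hΦ2 : MemLp Φ 2 μ := (Lp.memLp (sv : (AdelicGroupData.gl (m + 1) K).L2 μ)).ae_eq hae
  have hsvP : hΦ2.toLp Φ ∈ P.1 := by
    have h : hΦ2.toLp Φ = (sv : (AdelicGroupData.gl (m + 1) K).L2 μ) := Lp.ext (hΦ2.coeFn_toLp.trans hae.symm)
    rw [h]
    exact ContRepresentation.ClosedSubrep.mem_toSubmodule.1 sv.2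
  obtain ⟨ωP, hu, -, hcl⟩ := exists_centralCharacter_invQuot P hΦc hΦ2 hsvP
  have hWZ0 : ∀ (z : ideleGroup K) (g : GL (Fin (m + 1)) 𝔸),
      ‖W (Matrix.GeneralLinearGroup.scalar (Fin (m + 1)) z * g)‖ = ‖W g‖ := fun z g => by
    rw [hWdef, whittakerCoeff_scalar_mul (fun g' => hcl z g') g, norm_mul, hu z, one_mul]
  have hWZ : ∀ (z : ideleGroup K) (g : GL (Fin (m + 1)) 𝔸),
      ‖W (glDiagonal (m + 1) 𝔸 (Fin.snoc τ 1) * (Matrix.GeneralLinearGroup.scalar (Fin (m + 1)) z * g))‖ =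
        ‖W (glDiagonal (m + 1) 𝔸 (Fin.snoc τ 1) * g)‖ :=
    norm_translate_scalar_mul (Fin.snoc τ 1) hWZ0
  -- the Satake bounds `‖x_v i‖, ‖y_v a‖ ≤ q_v^{1/2}`
  have hxb : ∀ v ∉ S', ∀ i, ‖x v i‖ ≤ (v.residueCard : ℝ) ^ (1 / 2 : ℝ) := fun v hv i => by
    rw [← Real.sqrt_eq_rpow]
    exact norm_satakeParameter_le_sqrt_holds P hα (hSv v hv)
      (by rw [← hx v hv]; exact Multiset.mem_map_of_mem _ (Finset.mem_univ_val _))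
  have hyb : ∀ v ∉ S', ∀ a, ‖star (y v) a‖ ≤ (v.residueCard : ℝ) ^ (1 / 2 : ℝ) := fun v hv a => by
    rw [Pi.star_apply, norm_star, ← Real.sqrt_eq_rpow]
    exact norm_satakeParameter_le_sqrt_holds Q hγ (hSv v hv)
      (by rw [← hy v hv]; exact Multiset.mem_map_of_mem _ (Finset.mem_univ_val _))
  -- (5) the Euler factorisation at the parameter `s - 1/2`, the Euler product at `s`
  have hy' : ∀ v ∉ S', (Finset.univ : Finset (Fin m)).val.map (star (y v)) = (γ v).map conj := fun v hv => by
    rw [← hy v hv, Multiset.map_map]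
    rfl
  have hL := hasProd_partialPairL JacquetShalika1981_multipliable_partialPairL_holds P Q.conj (hα.mono hSS')
    (hγ.mono hSS').conj hs1
  have hs2 : s - 1 / 2 + 1 / 2 = s := by ring
  have hL' : HasProd (fun u : {v : HeightOneSpectrum (𝓞 K) // v ∉ S'} =>
      ((satakePairPolynomial (α u.1) ((γ u.1).map conj)).eval
        ((u.1.residueCard : ℂ) ^ (-(s - 1 / 2 + 1 / 2))))⁻¹)
      (partialPairL S' α (fun v => (γ v).map conj) s) := by
    rw [hs2]
    exact hL
  have heul := CornerEulerLimit.integral_eq_mul_setIntegral_of_hasProd hm νA νK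
    (W := fun g => W (glDiagonal (m + 1) 𝔸 (Fin.snoc τ 1) * g))
    (W' := fun g => star (W' (glDiagonal m 𝔸 τ * g)))
    (hWc.comp (continuous_const_mul _)) (hW'c.comp (continuous_const_mul _)).star hWZ hWu hW'u hxb hyb hs'
    hintτ (β := fun v => (γ v).map conj) hx hy' hL'
  beta_reduce at heul
  -- assembly
  calc jpssIntegral (Nat.lt_succ_self m) μ' Φ (star Φ') s
      = (C : ℂ) * ∫ p, I₁ p ∂(νA.prod νK) := by
        rw [hglob]
        exact congrArg (fun z : ℂ => (C : ℂ) * z) (integral_congr_ae (Eventually.of_forall h01))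
    _ = (C : ℂ) * (torusWeightC m K (s - 1 / 2) τ * ∫ p, torusPairIntegrandC m K
          (fun g => W (glDiagonal (m + 1) 𝔸 (Fin.snoc τ 1) * glCorner 𝔸 (Nat.le_succ m) g))
          (fun g => star (W' (glDiagonal m 𝔸 τ * g))) (fun _ => (1 : ℝ)) (s - 1 / 2) p ∂(νA.prod νK)) := by
        rw [hI₁, htr]
    _ = _ := by rw [heul]

end Main

/-- **STUB (W-CGT) — the corner global theorem in TRANSLATE form: `I(s; Φ, Φ̄') = C · w_{s-1/2}(τ) ·
L^{S'}(s, α ⊗ γ̄) · Ψ^τ_{S'}(s - 1/2)` on a right half-plane** (Cogdell (2004), Thm. 2.1–2.2 (Eulerian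
clause), §3.1 "translate the essential vector", Thm. 3.3, §4.2; Jacquet–Piatetski-Shapiro–Shalika (1983),
§2; the corner analogue of `GlobalPairTranslateGen.stub_global_pair_translate_gen`): the registered
signature, by `jpssIntegral_star_eq`. [cite: CogdellAnalyticTheory2004, §2.3 Thm. 2.1–2.2, §3.1 Thm. 3.3, §4.2] -/
theorem stub_corner_global_translate :
    ∀ {m : ℕ} {K : Type} [Field K] [NumberField K]
      [MeasurableSpace (AdeleRing (𝓞 K) K)] [BorelSpace (AdeleRing (𝓞 K) K)] (_hm : 0 < m)
      (μ : Measure (AdelicGroupData.gl (m + 1) K).automorphicQuotient)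
      [(AdelicGroupData.gl (m + 1) K).IsAutomorphicMeasure μ]
      (μ' : Measure (AdelicGroupData.gl m K).automorphicQuotient) [(AdelicGroupData.gl m K).IsAutomorphicMeasure μ']
      (νA : Measure (Fin m → ideleGroup K)) [IsHaarMeasure νA]
      (νK : Measure ↥(maximalCompactAdelic m K)) [IsHaarMeasure νK]
      (ν₀ : Measure ↥(adelicUnipotent (m + 1) K)) [IsHaarMeasure ν₀]
      (ν₀' : Measure ↥(adelicUnipotent m K)) [IsHaarMeasure ν₀'],
    ∃ C : ℝ, 0 < C ∧
      ∀ (P : CuspidalAutomorphicRepGL (m + 1) K μ) (Q : CuspidalAutomorphicRepGL m K μ')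
        {S : Set (HeightOneSpectrum (𝓞 K))} {α γ : SatakeFamily K},
        IsSatakeFamilyOf P S α → IsSatakeFamilyOf Q S γ →
      ∀ {Φ : (AdelicGroupData.gl (m + 1) K).automorphicQuotient → ℂ}
        {Φ' : (AdelicGroupData.gl m K).automorphicQuotient → ℂ}, Continuous Φ → Continuous Φ' →
      ∀ (sv : P.1.toSubmodule) (sv' : Q.1.toSubmodule),
        (((sv : (AdelicGroupData.gl (m + 1) K).L2 μ) : (AdelicGroupData.gl (m + 1) K).automorphicQuotient → ℂ)
          =ᵐ[μ] Φ) →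
        (((sv' : (AdelicGroupData.gl m K).L2 μ') : (AdelicGroupData.gl m K).automorphicQuotient → ℂ) =ᵐ[μ'] Φ') →
        IsCuspFormGL (m + 1) K (isCompact_glFiniteIntegralLevel_holds (m + 1) K)
          (invQuot (AdelicGroupData.gl (m + 1) K) Φ) →
        IsCuspFormGL m K (isCompact_glFiniteIntegralLevel_holds m K) (invQuot (AdelicGroupData.gl m K) Φ') →
      ∀ {𝔫₀ : Ideal (𝓞 K)}, 𝔫₀ ≠ 0 →
        (∀ k ∈ principalCongruenceLevel (m + 1) K 𝔫₀, ∀ y : GL (Fin (m + 1)) (AdeleRing (𝓞 K) K),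
          invQuot (AdelicGroupData.gl (m + 1) K) Φ (y * k) = invQuot (AdelicGroupData.gl (m + 1) K) Φ y) →
        (∀ k ∈ principalCongruenceLevel m K 𝔫₀, ∀ y : GL (Fin m) (AdeleRing (𝓞 K) K),
          invQuot (AdelicGroupData.gl m K) Φ' (y * k) = invQuot (AdelicGroupData.gl m K) Φ' y) →
      ∀ {S' : Set (HeightOneSpectrum (𝓞 K))}, S ⊆ S' → (∀ v ∉ S', ¬ v.asIdeal ∣ 𝔫₀) →
      ∀ (τ : Fin m → ideleGroup K),
        (∀ v ∉ S', ∃ (d : Fin (m + 1) → (v.adicCompletion K)ˣ) (a : (v.adicCompletion K)ˣ),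
          localComponent v (glDiagonal (m + 1) (AdeleRing (𝓞 K) K) (Fin.snoc τ 1)) =
            diagonalGL (Fin (m + 1)) (v.adicCompletion K) d ∧
          (∀ i j : Fin (m + 1), (i : ℕ) + 1 = j →
            (d i : v.adicCompletion K) * ((d j)⁻¹ : (v.adicCompletion K)ˣ) = a) ∧
          (∀ c ∈ 𝒪[v.adicCompletion K], (adeleAddChar K).adicComponent v (a * c) = 1) ∧
          ∀ ϖ : v.adicCompletion K, Valued.v ϖ = WithZero.exp (-1 : ℤ) →
            ∃ c ∈ 𝒪[v.adicCompletion K], (adeleAddChar K).adicComponent v (a * (ϖ⁻¹ * c)) ≠ 1) →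
      ∀ {x : HeightOneSpectrum (𝓞 K) → Fin (m + 1) → ℂ} {y : HeightOneSpectrum (𝓞 K) → Fin m → ℂ},
        (∀ v ∉ S', (Finset.univ : Finset (Fin (m + 1))).val.map (x v) = α v) →
        (∀ v ∉ S', (Finset.univ : Finset (Fin m)).val.map (y v) = γ v) →
      ∃ x₀ : ℝ, ∀ s : ℂ, x₀ < s.re →
        jpssIntegral (Nat.lt_succ_self m) μ' Φ (star Φ') s =
          (C : ℂ) * (torusWeightC m K (s - 1 / 2) τ *
            (partialPairL S' α (fun v => (γ v).map conj) s *
              ∫ p in unitBox {v | v ∉ S'} ×ˢ Set.univ, torusPairIntegrandC m K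
                (fun g => whittakerCoeff ν₀ (unipotentTateDomain (m + 1) K) (adeleAddChar K)
                  (invQuot (AdelicGroupData.gl (m + 1) K) Φ)
                  (glDiagonal (m + 1) (AdeleRing (𝓞 K) K) (Fin.snoc τ 1) *
                    glCorner (AdeleRing (𝓞 K) K) (Nat.le_succ m) g))
                (fun g => star (whittakerCoeff ν₀' (unipotentTateDomain m K) (adeleAddChar K)
                  (invQuot (AdelicGroupData.gl m K) Φ') (glDiagonal m (AdeleRing (𝓞 K) K) τ * g)))
                (fun _ => (1 : ℝ)) (s - 1 / 2) p ∂(νA.prod νK))) := by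
  intro m K _ _ _ _ hm μ _ μ' _ νA _ νK _ ν₀ _ ν₀' _
  exact jpssIntegral_star_eq hm μ μ' νA νK ν₀ ν₀'

end Summit.Langlands.Langlands.Theorems.CornerGlobalTranslate

end
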